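import Summits.Ventures.CertifiedManyBodySolver.Theorems.TcThermcert1SeamTwistInputs
import Summits.HubbardSuperconductivity.HubbardLadder.Bounds.ThermalStiffnessCeilingTPrime
import Literature.MathematicalPhysics.QuantumLattice.FermionRelabelling
import Literature.MathematicalPhysics.QuantumLattice.HyperoctahedralFockAction
import Literature.MathematicalPhysics.QuantumLattice.HubbardNNNHoppingFlux
import HarnessLib

/-!
# Spin-exchange blindness of the current covariance (negative-side helper for the cruxes K1′ / K1 of route `TcThermcert1`)

Disprover's helper (`--supports stmt-Ventures-24560`; crux K1′ `TcThermcert1.ThermalStiffnessCeilingU8b8_le_7o44`, line of record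
`Cruxes/ThermalStiffnessCeilingU8b8_le_7o44/Lines/gauge_qbp_far_seam.lean` v1.4, bet C8 `stub_currentClustering8`; equally the K1 twin's C10).
Companion of `CurrentCovarianceTRBlind` (time reversal). Hypothesis C of that line bounds, in the canonical-sector Gibbs state
`ω_p(X) = gibbsState β (H|_p) (X|_p)` of the flux-FREE torus `H = hubbardTorusTT'Flux L 0 U 0` on the `(2M, S^z = 0)` coordinate sector
`p = {s : #s = 2M ∧ 2·#{i ∈ s : spin i = 0} = 2M}`, the covariance `ω_p(A·j) − ω_p(A)·ω_p(j)` of an even local observable `A` with the plain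
(spin-summed) bond current `j`. Here a SECOND exact selection rule is proved, by GROUP COVARIANCE of compressed Gibbs states (the tree's
`gibbsState_toBlock_conj_of_sector`, `Summits/HubbardSuperconductivity/HubbardLadder/Bounds/ThermalStiffnessCeilingTPrime.lean`) under the
spin exchange `Γ = relabelMatrix Orb.spinSwap` (`(x,σ) ↦ (x,1−σ)`; `FermionRelabelling`, `HyperoctahedralFockAction`):

* `sector_spinSwap_iff` — the `(2M, S^z = 0)` sector is `Γ`-stable (the exchange swaps the spin-`0` and spin-`1` counts, which agree there);
* `gibbsState_toBlock_eq_zero_of_spinSwap_odd` — for every `Γ`-invariant `H`, every `Γ`-stable coordinate sector and every `Γ`-ODD `Y`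
  (`Γ Y Γᴴ = −Y`): `ω_p(Y) = 0` (any orbital set `Λ`, any `β`);
* `gibbsCov_fluxZeroBlock_farBond_eq_zero_of_spinSwap_odd` — on the torus, `H(1,U)` is `Γ`-invariant (`relabel_spinSwap_hamiltonianWith`) and
  `j` is `Γ`-even, so for EVERY spin-exchange-odd `A` the covariance with `j` is EXACTLY `0`, at every `U`, `β`, `L`, `M`. The odd class contains
  the local spin densities `n_{x↑} − n_{x↓}` (`relabel_spinSwap_szDensity`; even, local, Hermitian, sector preserving — inside the line's
  hypotheses) and the SPIN currents `j_↑ − j_↓`, which are time-reversal ODD and hence NOT covered by `CurrentCovarianceTRBlind`.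

Negative knowledge for the bet: together with the time-reversal rule, an observable that could refute Hypothesis C must be time-reversal ODD
**and** spin-exchange EVEN (charge loop currents, scalar spin chirality); spin-current / spin-density quasi-order is invisible to it.

HONEST FRAMING: finite-dimensional folklore (a signed permutation unitary commuting with `H` and preserving the sector); it proves NOTHING about
clustering at `U = 8`, and superconductivity in the Hubbard model is neither proved nor disproved by anything in this file.
-/

noncomputable section

open scoped ComplexOrder ComplexConjugate Matrix.Norms.L2Operator
open Matrix Finset
open Literature.MathematicalPhysics.QuantumLattice
open Literature.Probability.LatticeModels
open Summit.Ventures.CertifiedManyBodySolver.Theorems.TcThermcert1.GaugeQbpFarSeam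
open Summit.HubbardSuperconductivity.HubbardLadder.Bounds

namespace Summit.Ventures.CertifiedManyBodySolver.Theorems.TcThermcert1.CurrentCovarianceSpinFlipBlind

section Generic

variable {Λ : Type*} [LinearOrder Λ] [Fintype Λ]

omit [LinearOrder Λ] [Fintype Λ] in
/-- The spin label of the spin-exchanged orbital. [folklore] -/
theorem snd_ofLex_spinSwap (i : Orb Λ) :
    (ofLex ((Orb.spinSwap : Orb Λ ≃ Orb Λ) i)).2 = Equiv.swap (0 : Fin 2) 1 (ofLex i).2 := rfl

omit [LinearOrder Λ] [Fintype Λ] in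
/-- An orbital is spin-`0` after the exchange iff it was not spin-`0` before. [folklore] -/
theorem snd_ofLex_spinSwap_eq_zero_iff (i : Orb Λ) :
    (ofLex ((Orb.spinSwap : Orb Λ ≃ Orb Λ) i)).2 = 0 ↔ ¬ (ofLex i).2 = 0 := by
  rw [snd_ofLex_spinSwap]
  generalize (ofLex i).2 = σ
  revert σ
  decide

omit [LinearOrder Λ] [Fintype Λ] in
/-- The spin-`0` orbitals of the exchanged configuration are the images of its non-spin-`0` orbitals. [folklore] -/
theorem card_filter_spin_zero_spinSwap (s : Finset (Orb Λ)) :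
    (((Orb.spinSwap : Orb Λ ≃ Orb Λ).finsetCongr s).filter fun i => (ofLex i).2 = 0).card =
      (s.filter fun i => ¬ (ofLex i).2 = 0).card := by
  rw [Equiv.finsetCongr_apply, Finset.filter_map, Finset.card_map]
  exact congrArg Finset.card (Finset.filter_congr fun i _ => snd_ofLex_spinSwap_eq_zero_iff i)

omit [LinearOrder Λ] [Fintype Λ] in
/-- **The `(2M, S^z = 0)` coordinate sector is invariant under spin exchange.** [folklore] -/
theorem sector_spinSwap_iff (M : ℕ) (s : Finset (Orb Λ)) :
    (((Orb.spinSwap : Orb Λ ≃ Orb Λ).finsetCongr s).card = 2 * M ∧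
        2 * (((Orb.spinSwap : Orb Λ ≃ Orb Λ).finsetCongr s).filter fun i => (ofLex i).2 = 0).card = 2 * M) ↔
      (s.card = 2 * M ∧ 2 * (s.filter fun i => (ofLex i).2 = 0).card = 2 * M) := by
  have hc : ((Orb.spinSwap : Orb Λ ≃ Orb Λ).finsetCongr s).card = s.card := by
    rw [Equiv.finsetCongr_apply, Finset.card_map]
  have hsum := Finset.card_filter_add_card_filter_not (s := s) (fun i : Orb Λ => (ofLex i).2 = 0)
  rw [hc, card_filter_spin_zero_spinSwap]
  constructor
  · rintro ⟨h1, h2⟩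
    exact ⟨h1, by omega⟩
  · rintro ⟨h1, h2⟩
    exact ⟨h1, by omega⟩

/-- Spin exchange on a number operator. [folklore] -/
theorem relabel_spinSwap_numberOp (x : Λ) (σ : Fin 2) :
    relabel (Orb.spinSwap : Orb Λ ≃ Orb Λ) (numberOp x σ) = numberOp x (Equiv.swap (0 : Fin 2) 1 σ) := by
  rw [numberOp, map_mul, relabel_creation, relabel_annihilation, Orb.spinSwap_orb, numberOp]

/-- The local spin density `n_{x↑} − n_{x↓}` is ODD under spin exchange. [folklore] -/
theorem relabel_spinSwap_szDensity (x : Λ) :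
    relabel (Orb.spinSwap : Orb Λ ≃ Orb Λ) (numberOp x 0 - numberOp x 1) = -(numberOp x 0 - numberOp x 1) := by
  rw [map_sub, relabel_spinSwap_numberOp, relabel_spinSwap_numberOp, Equiv.swap_apply_left,
    Equiv.swap_apply_right, neg_sub]

/-- **A compressed Gibbs state of a spin-exchange-invariant Hamiltonian vanishes on every spin-exchange-ODD
observable**, for every coordinate sector `p` stable under the exchange: the signed permutation matrix
`Γ = relabelMatrix spinSwap` is unitary, commutes with `H`, does not connect `p` to its complement, so
`ω_p(Γ Y Γᴴ) = ω_p(Y)` (`gibbsState_toBlock_conj_of_sector`); with `Γ Y Γᴴ = −Y` this reads `−ω_p(Y) = ω_p(Y)`.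
[folklore] -/
theorem gibbsState_toBlock_eq_zero_of_spinSwap_odd (p : Finset (Orb Λ) → Prop) [DecidablePred p]
    (hp : ∀ s, p ((Orb.spinSwap : Orb Λ ≃ Orb Λ).finsetCongr s) ↔ p s)
    {H Y : Matrix (Finset (Orb Λ)) (Finset (Orb Λ)) ℂ}
    (hH : relabel (Orb.spinSwap : Orb Λ ≃ Orb Λ) H = H) (hY : relabel (Orb.spinSwap : Orb Λ ≃ Orb Λ) Y = -Y)
    (β : ℝ) : gibbsState β (H.toBlock p p) (Y.toBlock p p) = 0 := by
  have hR : ∀ s t, relabelMatrix (Orb.spinSwap : Orb Λ ≃ Orb Λ) s t ≠ 0 → (p s ↔ p t) := by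
    intro s t h
    have hst : s = (Orb.spinSwap : Orb Λ ≃ Orb Λ).finsetCongr t := by
      by_contra hne
      apply h
      unfold relabelMatrix
      exact if_neg hne
    rw [hst]
    exact hp t
  have h := gibbsState_toBlock_conj_of_sector p hR (relabelMatrix_mul_conjTranspose _)
    (relabelMatrix_mul_eq_mul_of_relabel_eq _ hH) β Y
  rw [← relabel_eq_relabelMatrix_mul, hY, neg_toBlock, map_neg] at h
  linear_combination (-(1 : ℂ) / 2) * h

/-- **Covariance form.** Under the same hypotheses, for a spin-exchange-EVEN `J` and a spin-exchange-ODD `A`: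
`ω_p(A·J) − ω_p(A)·ω_p(J) = 0`. [folklore] -/
theorem gibbsCov_toBlock_eq_zero_of_spinSwap_odd (p : Finset (Orb Λ) → Prop) [DecidablePred p]
    (hp : ∀ s, p ((Orb.spinSwap : Orb Λ ≃ Orb Λ).finsetCongr s) ↔ p s)
    {H A J : Matrix (Finset (Orb Λ)) (Finset (Orb Λ)) ℂ}
    (hH : relabel (Orb.spinSwap : Orb Λ ≃ Orb Λ) H = H) (hA : relabel (Orb.spinSwap : Orb Λ ≃ Orb Λ) A = -A)
    (hJ : relabel (Orb.spinSwap : Orb Λ ≃ Orb Λ) J = J) (β : ℝ) :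
    gibbsState β (H.toBlock p p) ((A * J).toBlock p p) -
        gibbsState β (H.toBlock p p) (A.toBlock p p) * gibbsState β (H.toBlock p p) (J.toBlock p p) = 0 := by
  have hAJ : relabel (Orb.spinSwap : Orb Λ ≃ Orb Λ) (A * J) = -(A * J) := by
    rw [map_mul, hA, hJ, neg_mul]
  rw [gibbsState_toBlock_eq_zero_of_spinSwap_odd p hp hH hAJ, gibbsState_toBlock_eq_zero_of_spinSwap_odd p hp hH hA,
    zero_mul, sub_zero]

/-- The plain bond current `Σ_σ (−i c†_{aσ} c_{bσ} + i c†_{bσ} c_{aσ})` (both spins summed) is spin-exchange EVEN. [folklore] -/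
theorem relabel_spinSwap_farBond (a b : Λ) :
    relabel (Orb.spinSwap : Orb Λ ≃ Orb Λ)
        (∑ σ : Fin 2, ((-Complex.I) • (creation (orb a σ) * annihilation (orb b σ)) +
          Complex.I • (creation (orb b σ) * annihilation (orb a σ)))) =
      ∑ σ : Fin 2, ((-Complex.I) • (creation (orb a σ) * annihilation (orb b σ)) +
          Complex.I • (creation (orb b σ) * annihilation (orb a σ))) := by
  rw [map_sum]
  refine Fintype.sum_equiv (Equiv.swap (0 : Fin 2) 1) _ _ fun σ => ?_
  rw [map_add, map_smul, map_smul, map_mul, map_mul, relabel_creation, relabel_annihilation, relabel_creation,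
    relabel_annihilation, Orb.spinSwap_orb, Orb.spinSwap_orb]

end Generic

section Torus

variable (L : ℕ) [NeZero L]

/-- The flux-free torus Hamiltonian `hubbardTorusTT'Flux L 0 U 0 = H(1, U)` is spin-exchange invariant
(tree `relabel_spinSwap_hamiltonianWith`). [folklore] -/
theorem relabel_spinSwap_hubbardTorusTT'Flux_zero (U : ℝ) :
    relabel (Orb.spinSwap : Orb (FermionTorus 2 L) ≃ Orb (FermionTorus 2 L)) (hubbardTorusTT'Flux L 0 U 0) =
      hubbardTorusTT'Flux L 0 U 0 := by
  rw [hubbardTorusTT'Flux_tPrime_zero, hubbardTorusFlux_zero, ← hubbardTorusWith_zero]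
  exact relabel_spinSwap_hamiltonianWith (fermionTorusGraph 2 L) 1 U 0

/-- **SPIN-EXCHANGE BLINDNESS of the current covariance.** In the compressed Gibbs state of the flux-free
torus `hubbardTorusTT'Flux L 0 U 0` on ANY `(2M, S^z = 0)` coordinate sector, the connected correlation
`ω_p(A·j) − ω_p(A)·ω_p(j)` of the plain bond current `j` with ANY spin-exchange-ODD observable `A`
(`Γ A Γᴴ = −A`: local spin densities `n_{x↑} − n_{x↓}`, SPIN currents `j_↑ − j_↓` — which are time-reversal
ODD, so NOT covered by the time-reversal blindness `CurrentCovarianceTRBlind` —, odd spin-density strings, …)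
is EXACTLY `0`, at every `U`, `β`, `L`, `M`; both `ω_p(A·j)` and `ω_p(A)` vanish separately. Negative knowledge
for the bet C8 of the line `gauge_qbp_far_seam`: a refuting observable must be time-reversal ODD **and**
spin-exchange EVEN (charge loop currents, scalar spin chirality). [folklore] -/
theorem gibbsCov_fluxZeroBlock_farBond_eq_zero_of_spinSwap_odd (U β : ℝ) (X y : ZMod L) (M : ℕ)
    {A : Matrix (Finset (Orb (FermionTorus 2 L))) (Finset (Orb (FermionTorus 2 L))) ℂ}
    (hA : relabel (Orb.spinSwap : Orb (FermionTorus 2 L) ≃ Orb (FermionTorus 2 L)) A = -A) :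
    gibbsState β ((hubbardTorusTT'Flux L 0 U 0).toBlock
          (fun s => s.card = 2 * M ∧ 2 * (s.filter fun i => (ofLex i).2 = 0).card = 2 * M)
          (fun s => s.card = 2 * M ∧ 2 * (s.filter fun i => (ofLex i).2 = 0).card = 2 * M))
        ((A * (∑ σ : Fin 2,
            ((-Complex.I) • (creation (orb (FermionTorus.ofTorusSite (![X, y] : TorusSite 2 L)) σ) *
                annihilation (orb (FermionTorus.ofTorusSite (![X - 1, y] : TorusSite 2 L)) σ)) +
              Complex.I • (creation (orb (FermionTorus.ofTorusSite (![X - 1, y] : TorusSite 2 L)) σ) *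
                annihilation (orb (FermionTorus.ofTorusSite (![X, y] : TorusSite 2 L)) σ))))).toBlock
          (fun s => s.card = 2 * M ∧ 2 * (s.filter fun i => (ofLex i).2 = 0).card = 2 * M)
          (fun s => s.card = 2 * M ∧ 2 * (s.filter fun i => (ofLex i).2 = 0).card = 2 * M)) -
      gibbsState β ((hubbardTorusTT'Flux L 0 U 0).toBlock
          (fun s => s.card = 2 * M ∧ 2 * (s.filter fun i => (ofLex i).2 = 0).card = 2 * M)
          (fun s => s.card = 2 * M ∧ 2 * (s.filter fun i => (ofLex i).2 = 0).card = 2 * M))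
        (A.toBlock
          (fun s => s.card = 2 * M ∧ 2 * (s.filter fun i => (ofLex i).2 = 0).card = 2 * M)
          (fun s => s.card = 2 * M ∧ 2 * (s.filter fun i => (ofLex i).2 = 0).card = 2 * M)) *
      gibbsState β ((hubbardTorusTT'Flux L 0 U 0).toBlock
          (fun s => s.card = 2 * M ∧ 2 * (s.filter fun i => (ofLex i).2 = 0).card = 2 * M)
          (fun s => s.card = 2 * M ∧ 2 * (s.filter fun i => (ofLex i).2 = 0).card = 2 * M))
        ((∑ σ : Fin 2,
            ((-Complex.I) • (creation (orb (FermionTorus.ofTorusSite (![X, y] : TorusSite 2 L)) σ) *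
                annihilation (orb (FermionTorus.ofTorusSite (![X - 1, y] : TorusSite 2 L)) σ)) +
              Complex.I • (creation (orb (FermionTorus.ofTorusSite (![X - 1, y] : TorusSite 2 L)) σ) *
                annihilation (orb (FermionTorus.ofTorusSite (![X, y] : TorusSite 2 L)) σ)))).toBlock
          (fun s => s.card = 2 * M ∧ 2 * (s.filter fun i => (ofLex i).2 = 0).card = 2 * M)
          (fun s => s.card = 2 * M ∧ 2 * (s.filter fun i => (ofLex i).2 = 0).card = 2 * M)) = 0 := by
  have h := gibbsCov_toBlock_eq_zero_of_spinSwap_odd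
    (p := fun s => s.card = 2 * M ∧ 2 * (s.filter fun i => (ofLex i).2 = 0).card = 2 * M)
    (fun s => sector_spinSwap_iff M s)
    (H := hubbardTorusTT'Flux L 0 U 0) (A := A)
    (J := (∑ σ : Fin 2,
            ((-Complex.I) • (creation (orb (FermionTorus.ofTorusSite (![X, y] : TorusSite 2 L)) σ) *
                annihilation (orb (FermionTorus.ofTorusSite (![X - 1, y] : TorusSite 2 L)) σ)) +
              Complex.I • (creation (orb (FermionTorus.ofTorusSite (![X - 1, y] : TorusSite 2 L)) σ) *
                annihilation (orb (FermionTorus.ofTorusSite (![X, y] : TorusSite 2 L)) σ)))))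
    (relabel_spinSwap_hubbardTorusTT'Flux_zero L U) hA
    (relabel_spinSwap_farBond (FermionTorus.ofTorusSite (![X, y] : TorusSite 2 L))
      (FermionTorus.ofTorusSite (![X - 1, y] : TorusSite 2 L))) β
  convert h using 6

end Torus

end Summit.Ventures.CertifiedManyBodySolver.Theorems.TcThermcert1.CurrentCovarianceSpinFlipBlind
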